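import Mathlib.NumberTheory.ModularForms.CongruenceSubgroups
import Mathlib.NumberTheory.LegendreSymbol.JacobiSymbol
import Mathlib.RingTheory.Coprime.Lemmas
import Mathlib.Data.Int.GCD
import HarnessLib

/-!
# Crux `PrintCFram.BottomClassIndexLawFiveLe` (stmt-BirchSwinnertonDyer-20372), line `eisenstein-resource-bdp-line` (registry v26 → v27):
# THE FLIPPED-CUSP RUNG, typing item T2 — THE MATRIX FACTORISATION `τ_j · W_Q = γ_j · T_j` with `γ_j ∈ Γ₀(M)`, `δ(γ_j) ≡ q² (mod M)`
# (cell `bsd-print-cfram`, width seat `bsd-line-cfram-p1-w2` g14; THEOREMS ONLY, `--supports` 20372; BSD is not proved by any of this)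

HONEST FRAMING. Nothing here is a statement about BSD, about a curve, or about a modular form: this is the `2 × 2` integer algebra behind LEAD g14's
flipped-cusp rung (crux notes `Lines/eisenstein-resource-bdp-line-lead-g14.md` §2.1, typing list T1–T5 of STATUS 07:30:58Z / 07:35:39Z; T2 = this
file). In §2.1 one slashes the Legendre-cut form `P_σ f = q⁻² Σ_{j mod q²} h_σ(j) f(z + j/q²)` by the Fricke-type matrix
`W_Q = [[q⁴a, b],[Mq⁴, q⁴]]` (`q⁴a − Mb = 1`, determinant `q⁴`); the translates with `q ∤ j` factor as

    [[q², j],[0, q²]] · W_Q = γ_j · [[q⁴, q²y_j],[0, q⁴]],   γ_j ∈ Γ₀(M),  det γ_j = 1,  γ_j ≡ [[*, *],[0, q²]] (mod M),  j·M·y_j ≡ b (mod q²)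

(the left factor is `q²·τ_j`, `τ_j = [[1, j/q²],[0,1]]`; the right factor is `q²·[[q², y_j],[0, q²]]`), so that `f | τ_j W_Q = f(z + y_j/q²)` once the
`θ`-multiplier of `γ_j` is `1` (T3). Since `M·b ≡ −1 (mod q⁴)`, the congruence reads `y_j ≡ −M̄²·j̄ (mod q²)` — LEAD's `y_j`. We prove exactly this, with
`γ_j` EXPLICIT: `γ_j = [[q²a + jM, c + j − a·y_j],[Mq², q² − M·y_j]]` where `b − jM·y_j = q²·c`.

* §1 arithmetic: from `q⁴a − Mb = 1`, `q` and `M` are coprime and `M·b ≡ −1 (mod q⁴)`; for `j` prime to `q` a solution `y` of `j·M·y ≡ b (mod q²)`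
  exists, and any solution has `y ≡ −M̄²j̄`-shape `M²·j·y ≡ −M (mod q²)`.
* §2 `translate_mul_fricke_eq` — the identity for a GIVEN solution `y` (explicit `γ_j`, integrality from the divisibility witness), with
  `det γ_j = 1`, `M ∣ (γ_j)₂₁`, `(γ_j)₂₂ ≡ q² (mod M)`, `(γ_j)₁₁ ≡ q²a (mod M)`.
* §3 `exists_gamma0_translate_mul_fricke_eq` — packaged in Mathlib's `SL(2, ℤ)` / `CongruenceSubgroup.Gamma0 M` currency:
  `∃ (γ : SL(2,ℤ)) (y : ℤ), γ ∈ Gamma0 M ∧ (γ 1 1 : ZMod M) = q² ∧ j·M·y ≡ b [ZMOD q²] ∧ [[q², j],[0, q²]]·W_Q = ↑γ·[[q⁴, q²y],[0, q⁴]]`;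
  §3b the `q ∥ j` translates (`γ'` with lower-left `M·q`); §3c `exists_gamma0_translate_mul_fricke_eq_normalised` — the freedom `y ↦ y + q²t`
  used to take `y` even and `≤ 0`, so that `δ = γ 1 1 = q² − M·y` is `> 0`, `≡ 1 (mod 8)` (for `4 ∣ M`), prime to `q`, and `M²·j·y ≡ −1 (mod q²)`
  and the Jacobi value `J(Mq² | δ) = 1` of the `θ`-multiplier (§3c `jacobiSym_level_mul_sq_eq_one`: `M = 2^e·m`, `χ₈(δ) = 1`, reciprocity at
  `δ ≡ 1 (mod 4)`, `δ ≡ q² (mod m)`).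
* §4 the Fricke data exist: `q ⊥ M ⟹ ∃ a b, q⁴a − Mb = 1`.

The slash computation (T3), the finite Fourier lemma (T1, w8 g9) and the assembly (T5) are other seats'. beyond-print theorem: NO.
References: [Shimura1973, Prop. 1.3–1.5] (half-integral weight slash/translates); [AtkinLehner1970, §6] (the `W_Q` matrices); registry
`Cruxes/BottomClassIndexLawFiveLe/Lines/eisenstein_resource_bdp_line.lean`; crux notes lead-g14 §2.1.
-/

set_option autoImplicit false
-- summit-side namespace `Summit.BirchSwinnertonDyer.BirchSwinnertonDyer.…` (single-conjunct summit, D-0017 layout)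
set_option linter.dupNamespace false

namespace Summit.BirchSwinnertonDyer.BirchSwinnertonDyer.Theorems.PrintCFram.FlipRung

open Matrix
open scoped MatrixGroups NumberTheorySymbols

/-! ## §1 Arithmetic of the Fricke data `q⁴a − Mb = 1` -/

/-- From `q⁴a − Mb = 1`: `q` and `M` are coprime. [folklore] -/
theorem isCoprime_of_fricke_det {M q a b : ℤ} (hdet : q ^ 4 * a - M * b = 1) : IsCoprime q M := by
  refine ⟨q ^ 3 * a, -b, ?_⟩
  linear_combination hdet

/-- From `q⁴a − Mb = 1`: `M·b ≡ −1 (mod q⁴)`. [folklore] -/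
theorem mul_emod_of_fricke_det {M q a b : ℤ} (hdet : q ^ 4 * a - M * b = 1) : M * b ≡ -1 [ZMOD q ^ 4] := by
  refine Int.modEq_iff_dvd.mpr ⟨-a, ?_⟩
  linear_combination hdet

/-- For `j` prime to `q` and Fricke data `q⁴a − Mb = 1` there is `y` with `j·M·y ≡ b (mod q²)`. [folklore] -/
theorem exists_mul_mul_modEq_of_fricke_det {M q a b j : ℤ} (hdet : q ^ 4 * a - M * b = 1) (hj : IsCoprime j q) :
    ∃ y : ℤ, j * M * y ≡ b [ZMOD q ^ 2] := by
  have hM : IsCoprime M (q ^ 2) := (isCoprime_of_fricke_det hdet).symm.pow_right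
  have hjq : IsCoprime j (q ^ 2) := hj.pow_right
  obtain ⟨s, t, hst⟩ := (hjq.mul_left hM)
  refine ⟨s * b, Int.modEq_iff_dvd.mpr ⟨t * b, ?_⟩⟩
  linear_combination (-b) * hst

/-- Any solution of `j·M·y ≡ b (mod q²)` has LEAD's shape `y ≡ −M̄²·j̄ (mod q²)`: `M²·j·y ≡ −1 (mod q²)` (multiply by `M`, use `Mb ≡ −1`).
[folklore] -/
theorem sq_mul_mul_modEq_neg_one_of_solution {M q a b j y : ℤ} (hdet : q ^ 4 * a - M * b = 1)
    (hy : j * M * y ≡ b [ZMOD q ^ 2]) : M ^ 2 * j * y ≡ -1 [ZMOD q ^ 2] := by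
  have h1 : M * b ≡ -1 [ZMOD q ^ 2] := (mul_emod_of_fricke_det hdet).of_dvd ⟨q ^ 2, by ring⟩
  have h2 : M * (j * M * y) ≡ M * b [ZMOD q ^ 2] := hy.mul_left M
  have e : M ^ 2 * j * y = M * (j * M * y) := by ring
  rw [e]
  exact h2.trans h1

/-! ## §2 The factorisation for a given solution `y` -/

/-- **`[[q², j],[0, q²]] · W_Q = γ_j · [[q⁴, q² y],[0, q⁴]]` with `γ_j` EXPLICIT and in `Γ₀(M)` shape.** For Fricke data `q⁴a − Mb = 1` and a solution
`y` of `j·M·y ≡ b (mod q²)` with witness `b − j·M·y = q²·c`, put `γ_j := [[q²a + jM, c + j − a·y],[M·q², q² − M·y]]`. Then the identity holds,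
`det γ_j = 1`, the lower-left entry is `M·q²` and the lower-right entry is `≡ q² (mod M)`. (Here `[[q², j],[0,q²]] = q²·τ_j` with
`τ_j = [[1, j/q²],[0, 1]]` and `[[q⁴, q²y],[0,q⁴]] = q²·[[q², y],[0, q²]]`: LEAD g14's `τ_j·W_Q = γ_j·[[q², y_j],[0, q²]]`, cleared of denominators.)
[cite: AtkinLehner1970, §6 (the matrices W_Q)] [cite: Shimura1973, Prop. 1.5] -/
theorem translate_mul_fricke_eq {M q a b j y c : ℤ} (hc : b - j * M * y = q ^ 2 * c) :
    !![q ^ 2, j; 0, q ^ 2] * !![q ^ 4 * a, b; M * q ^ 4, q ^ 4] =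
      !![q ^ 2 * a + j * M, c + j - a * y; M * q ^ 2, q ^ 2 - M * y] * !![q ^ 4, q ^ 2 * y; 0, q ^ 4] := by
  rw [Matrix.mul_fin_two, Matrix.mul_fin_two]
  have e11 : q ^ 2 * (q ^ 4 * a) + j * (M * q ^ 4) = (q ^ 2 * a + j * M) * q ^ 4 + (c + j - a * y) * 0 := by ring
  have e12 : q ^ 2 * b + j * q ^ 4 = (q ^ 2 * a + j * M) * (q ^ 2 * y) + (c + j - a * y) * q ^ 4 := by
    linear_combination q ^ 2 * hc
  have e21 : (0 : ℤ) * (q ^ 4 * a) + q ^ 2 * (M * q ^ 4) = M * q ^ 2 * q ^ 4 + (q ^ 2 - M * y) * 0 := by ring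
  have e22 : (0 : ℤ) * b + q ^ 2 * q ^ 4 = M * q ^ 2 * (q ^ 2 * y) + (q ^ 2 - M * y) * q ^ 4 := by ring
  rw [e11, e12, e21, e22]

/-- The factorisation in LEAD g14's rational form `τ_j · W_Q = γ_j · [[q², y_j],[0, q²]]`, `τ_j = [[1, j/q²],[0, 1]]` (divide §2 by `q²`).
[cite: Shimura1973, Prop. 1.5] -/
theorem translate_mul_fricke_eq_rat {M q a b j y c : ℤ} (hq : q ≠ 0) (hc : b - j * M * y = q ^ 2 * c) :
    !![(1 : ℚ), (j : ℚ) / (q : ℚ) ^ 2; 0, 1] * !![(q : ℚ) ^ 4 * a, (b : ℚ); (M : ℚ) * (q : ℚ) ^ 4, (q : ℚ) ^ 4] =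
      !![(q : ℚ) ^ 2 * a + j * M, (c : ℚ) + j - a * y; (M : ℚ) * (q : ℚ) ^ 2, (q : ℚ) ^ 2 - M * y] *
        !![(q : ℚ) ^ 2, (y : ℚ); 0, (q : ℚ) ^ 2] := by
  have hq' : (q : ℚ) ≠ 0 := by exact_mod_cast hq
  have hq2 : (q : ℚ) ^ 2 ≠ 0 := pow_ne_zero 2 hq'
  have hcQ : (b : ℚ) - j * M * y = (q : ℚ) ^ 2 * c := by exact_mod_cast hc
  rw [Matrix.mul_fin_two, Matrix.mul_fin_two]
  have e11 : (1 : ℚ) * ((q : ℚ) ^ 4 * a) + (j : ℚ) / (q : ℚ) ^ 2 * ((M : ℚ) * (q : ℚ) ^ 4) =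
      ((q : ℚ) ^ 2 * a + j * M) * (q : ℚ) ^ 2 + ((c : ℚ) + j - a * y) * 0 := by
    field_simp
    ring
  have e12 : (1 : ℚ) * (b : ℚ) + (j : ℚ) / (q : ℚ) ^ 2 * (q : ℚ) ^ 4 =
      ((q : ℚ) ^ 2 * a + j * M) * (y : ℚ) + ((c : ℚ) + j - a * y) * (q : ℚ) ^ 2 := by
    field_simp
    linear_combination hcQ
  have e21 : (0 : ℚ) * ((q : ℚ) ^ 4 * a) + 1 * ((M : ℚ) * (q : ℚ) ^ 4) =
      (M : ℚ) * (q : ℚ) ^ 2 * (q : ℚ) ^ 2 + ((q : ℚ) ^ 2 - M * y) * 0 := by ring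
  have e22 : (0 : ℚ) * (b : ℚ) + 1 * (q : ℚ) ^ 4 = (M : ℚ) * (q : ℚ) ^ 2 * (y : ℚ) + ((q : ℚ) ^ 2 - M * y) * (q : ℚ) ^ 2 := by
    ring
  rw [e11, e12, e21, e22]

/-- `det γ_j = 1` for the explicit `γ_j` (from `q⁴a − Mb = 1` and the witness `b − jMy = q²c`). [folklore] -/
theorem det_gammaJ_eq_one {M q a b j y c : ℤ} (hdet : q ^ 4 * a - M * b = 1) (hc : b - j * M * y = q ^ 2 * c) :
    Matrix.det !![q ^ 2 * a + j * M, c + j - a * y; M * q ^ 2, q ^ 2 - M * y] = 1 := by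
  rw [Matrix.det_fin_two_of]
  linear_combination hdet + M * hc

/-! ## §3 Packaged: existence of `γ_j ∈ Γ₀(M)` and `y_j` -/

/-- **THE MATRIX FACTORISATION (T2).** For Fricke data `q⁴a − Mb = 1` (so `W_Q = [[q⁴a, b],[Mq⁴, q⁴]]` has determinant `q⁴`) and every `j` prime
to `q` there are `γ ∈ Γ₀(M)` with lower-right entry `≡ q² (mod M)` and `y` with `j·M·y ≡ b (mod q²)` (equivalently `M²·j·y ≡ −1`, i.e.
`y ≡ −M̄²·j̄ (mod q²)`, by `sq_mul_mul_modEq_neg_one_of_solution`) such that `[[q², j],[0, q²]]·W_Q = γ·[[q⁴, q²y],[0, q⁴]]` — LEAD g14's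
`τ_j·W_Q = γ_j·[[q², y_j],[0, q²]]` (crux notes lead-g14 §2.1) cleared of the denominator `q²`. [cite: AtkinLehner1970, §6] [cite: Shimura1973, Prop. 1.5] -/
theorem exists_gamma0_translate_mul_fricke_eq {M : ℕ} {q a b : ℤ} (hdet : q ^ 4 * a - (M : ℤ) * b = 1) {j : ℤ}
    (hj : IsCoprime j q) :
    ∃ (γ : SL(2, ℤ)) (y : ℤ), γ ∈ CongruenceSubgroup.Gamma0 M ∧ ((γ 1 1 : ℤ) : ZMod M) = (q : ZMod M) ^ 2 ∧
      ((γ 0 0 : ℤ) : ZMod M) = (q : ZMod M) ^ 2 * (a : ZMod M) ∧ (γ 1 0 : ℤ) = (M : ℤ) * q ^ 2 ∧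
      j * (M : ℤ) * y ≡ b [ZMOD q ^ 2] ∧
      !![q ^ 2, j; 0, q ^ 2] * !![q ^ 4 * a, b; (M : ℤ) * q ^ 4, q ^ 4] =
        (γ : Matrix (Fin 2) (Fin 2) ℤ) * !![q ^ 4, q ^ 2 * y; 0, q ^ 4] := by
  obtain ⟨y, hy⟩ := exists_mul_mul_modEq_of_fricke_det hdet hj
  obtain ⟨c, hc⟩ : (q ^ 2 : ℤ) ∣ b - j * (M : ℤ) * y := Int.ModEq.dvd hy
  refine ⟨⟨!![q ^ 2 * a + j * M, c + j - a * y; (M : ℤ) * q ^ 2, q ^ 2 - (M : ℤ) * y], det_gammaJ_eq_one hdet hc⟩, y,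
    ?_, ?_, ?_, ?_, hy, ?_⟩
  · rw [CongruenceSubgroup.Gamma0_mem]
    simp
  · simp
  · simp
  · simp
  · exact translate_mul_fricke_eq hc

/-- The factorisation read in any commutative ring (e.g. `ℝ`, for the slash action): cast entrywise. [folklore] -/
theorem translate_mul_fricke_eq_map {R : Type*} [CommRing R] {M q a b j y c : ℤ} (hc : b - j * M * y = q ^ 2 * c) :
    (!![q ^ 2, j; 0, q ^ 2] : Matrix (Fin 2) (Fin 2) ℤ).map (Int.castRingHom R) *
        (!![q ^ 4 * a, b; M * q ^ 4, q ^ 4] : Matrix (Fin 2) (Fin 2) ℤ).map (Int.castRingHom R) =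
      (!![q ^ 2 * a + j * M, c + j - a * y; M * q ^ 2, q ^ 2 - M * y] : Matrix (Fin 2) (Fin 2) ℤ).map (Int.castRingHom R) *
        (!![q ^ 4, q ^ 2 * y; 0, q ^ 4] : Matrix (Fin 2) (Fin 2) ℤ).map (Int.castRingHom R) := by
  rw [← Matrix.map_mul, ← Matrix.map_mul, translate_mul_fricke_eq hc]

/-! ## §3b The translates with `q ∥ j` (lower-left entry `M·q`) -/

/-- **`[[q², q·j₁],[0, q²]] · W_Q = γ' · [[q⁵, q²x],[0, q³]]` for `q ∤ j₁`**, with `γ' = [[qa + j₁M, c' + j₁q² − a·x],[M·q, q³ − M·x]]`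
explicit (`b − j₁·M·x = q·c'`), `det γ' = 1`, lower-left `M·q`: the translates `j = q·j₁` of LEAD g14 §2.1 («their `γ_j` has lower-left `Mq`»),
which land on frequencies divisible by `q²`. [cite: AtkinLehner1970, §6] -/
theorem translate_mul_fricke_eq_of_dvd {M q a b j₁ x c' : ℤ} (hc : b - j₁ * M * x = q * c') :
    !![q ^ 2, q * j₁; 0, q ^ 2] * !![q ^ 4 * a, b; M * q ^ 4, q ^ 4] =
      !![q * a + j₁ * M, c' + j₁ * q ^ 2 - a * x; M * q, q ^ 3 - M * x] * !![q ^ 5, q ^ 2 * x; 0, q ^ 3] := by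
  rw [Matrix.mul_fin_two, Matrix.mul_fin_two]
  have e11 : q ^ 2 * (q ^ 4 * a) + q * j₁ * (M * q ^ 4) = (q * a + j₁ * M) * q ^ 5 + (c' + j₁ * q ^ 2 - a * x) * 0 := by ring
  have e12 : q ^ 2 * b + q * j₁ * q ^ 4 = (q * a + j₁ * M) * (q ^ 2 * x) + (c' + j₁ * q ^ 2 - a * x) * q ^ 3 := by
    linear_combination q ^ 2 * hc
  have e21 : (0 : ℤ) * (q ^ 4 * a) + q ^ 2 * (M * q ^ 4) = M * q * q ^ 5 + (q ^ 3 - M * x) * 0 := by ring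
  have e22 : (0 : ℤ) * b + q ^ 2 * q ^ 4 = M * q * (q ^ 2 * x) + (q ^ 3 - M * x) * q ^ 3 := by ring
  rw [e11, e12, e21, e22]

/-- `det γ' = 1` for the explicit `γ'` of the `q ∥ j` translates. [folklore] -/
theorem det_gamma'_eq_one {M q a b j₁ x c' : ℤ} (hdet : q ^ 4 * a - M * b = 1) (hc : b - j₁ * M * x = q * c') :
    Matrix.det !![q * a + j₁ * M, c' + j₁ * q ^ 2 - a * x; M * q, q ^ 3 - M * x] = 1 := by
  rw [Matrix.det_fin_two_of]
  linear_combination hdet + M * hc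

/-- **The `q ∥ j` factorisation packaged:** for Fricke data and `j₁` prime to `q`, `∃ γ ∈ Γ₀(M)` with lower-left entry `M·q` and `x` with
`j₁·M·x ≡ b (mod q)` such that `[[q², q·j₁],[0, q²]]·W_Q = ↑γ·[[q⁵, q²x],[0, q³]]`. [cite: AtkinLehner1970, §6] -/
theorem exists_gamma0_translate_mul_fricke_eq_of_dvd {M : ℕ} {q a b : ℤ} (hdet : q ^ 4 * a - (M : ℤ) * b = 1) {j₁ : ℤ}
    (hj : IsCoprime j₁ q) :
    ∃ (γ : SL(2, ℤ)) (x : ℤ), γ ∈ CongruenceSubgroup.Gamma0 M ∧ (γ 1 0 : ℤ) = (M : ℤ) * q ∧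
      j₁ * (M : ℤ) * x ≡ b [ZMOD q] ∧
      !![q ^ 2, q * j₁; 0, q ^ 2] * !![q ^ 4 * a, b; (M : ℤ) * q ^ 4, q ^ 4] =
        (γ : Matrix (Fin 2) (Fin 2) ℤ) * !![q ^ 5, q ^ 2 * x; 0, q ^ 3] := by
  -- a solution `x` of `j₁ M x ≡ b (mod q)`
  have hM : IsCoprime (M : ℤ) q := (isCoprime_of_fricke_det hdet).symm
  obtain ⟨s, t, hst⟩ := hj.mul_left hM
  have hx : j₁ * (M : ℤ) * (s * b) ≡ b [ZMOD q] :=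
    Int.modEq_iff_dvd.mpr ⟨t * b, by linear_combination (-b) * hst⟩
  obtain ⟨c', hc⟩ : (q : ℤ) ∣ b - j₁ * (M : ℤ) * (s * b) := Int.ModEq.dvd hx
  refine ⟨⟨!![q * a + j₁ * M, c' + j₁ * q ^ 2 - a * (s * b); (M : ℤ) * q, q ^ 3 - (M : ℤ) * (s * b)],
      det_gamma'_eq_one hdet hc⟩, s * b, ?_, ?_, hx, ?_⟩
  · rw [CongruenceSubgroup.Gamma0_mem]
    simp
  · simp
  · exact translate_mul_fricke_eq_of_dvd hc

/-! ## §3c The Jacobi value of the θ-multiplier: `J(M·q² | δ) = 1` -/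

/-- **`J(M·q² | δ) = 1`** for `δ ≡ 1 (mod 8)`, `δ ≡ q² (mod M)`, `δ` prime to `q`, `q` prime to `M` (`M ≠ 0`): write `M = 2^e·m` with `m` odd;
`J(2 | δ) = χ₈(δ) = 1`, `J(m | δ) = J(δ | m) = J(q² | m) = 1` by reciprocity (`δ ≡ 1 (mod 4)`), and `J(q² | δ) = 1`. This is the Jacobi factor
`(c/d)` of the `θ`-multiplier of `γ_j` (`c = Mq²`, `d = δ_j`). [cite: Shimura1973, Prop. 1.5 (the θ-multiplier)] [cite: IrelandRosen1990, Prop. 5.2.2] -/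
theorem jacobiSym_level_mul_sq_eq_one {M : ℕ} (hM0 : M ≠ 0) {q : ℤ} {d : ℕ} (hd8 : d % 8 = 1)
    (hdM : (d : ℤ) ≡ q ^ 2 [ZMOD M]) (hqd : IsCoprime q d) (hqM : IsCoprime q M) :
    J((M : ℤ) * q ^ 2 | d) = 1 := by
  have hdodd : Odd d := Nat.odd_iff.mpr (by omega)
  have hd4 : d % 4 = 1 := by omega
  -- `J(q² | d) = 1`
  have hq2 : J(q ^ 2 | d) = 1 :=
    jacobiSym.sq_one' (by rw [Int.isCoprime_iff_gcd_eq_one] at hqd; exact_mod_cast hqd)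
  rw [jacobiSym.mul_left, hq2, mul_one]
  -- `M = 2^e · m`, `m` odd
  obtain ⟨e, m, hm, rfl⟩ := Nat.exists_eq_two_pow_mul_odd hM0
  have h8 : ZMod.χ₈ (d : ZMod 8) = 1 := by
    rw [ZMod.χ₈_nat_eq_if_mod_eight]
    have hd2 : d % 2 = 1 := by omega
    simp [hd8, hd2]
  push_cast
  rw [jacobiSym.mul_left, jacobiSym.pow_left, jacobiSym.at_two hdodd, h8, one_pow, one_mul]
  -- `J(m | d) = J(d | m) = J(q² | m) = 1`
  rw [jacobiSym.quadratic_reciprocity_one_mod_four' hm hd4]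
  have hmM : (m : ℤ) ∣ ((2 ^ e * m : ℕ) : ℤ) := ⟨2 ^ e, by push_cast; ring⟩
  have hdm : (d : ℤ) % m = q ^ 2 % m := Int.ModEq.of_dvd hmM hdM
  rw [jacobiSym.mod_left' hdm]
  have hqm : IsCoprime q (m : ℤ) := by
    have : IsCoprime q (((2 : ℤ) ^ e) * (m : ℤ)) := by exact_mod_cast hqM
    exact this.of_mul_right_right
  exact jacobiSym.sq_one' (by rw [Int.isCoprime_iff_gcd_eq_one] at hqm; exact_mod_cast hqm)

/-! ## §3d The freedom `y ↦ y + q²t`: `y` even and `≤ 0`, so `δ = q² − My > 0`, `δ ≡ 1 (mod 8)` when `4 ∣ M`, `δ` prime to `q` -/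

/-- `q` odd ⟹ `8 ∣ q² − 1`. [folklore] -/
theorem eight_dvd_sq_sub_one_of_odd {q : ℤ} (hq : Odd q) : (8 : ℤ) ∣ q ^ 2 - 1 := by
  obtain ⟨r, rfl⟩ := hq
  have h2 : (2 : ℤ) ∣ r * (r + 1) := Int.even_mul_succ_self r |>.two_dvd
  obtain ⟨s, hs⟩ := h2
  exact ⟨s, by linear_combination 4 * hs⟩

/-- **THE MATRIX FACTORISATION WITH THE θ-MULTIPLIER NORMALISATIONS (T2, LEAD g14's currency decision 07:41:35Z).** As
`exists_gamma0_translate_mul_fricke_eq`, using the freedom `y ↦ y + q²t` to take `y` EVEN and `≤ 0`: then the lower-right entry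
`δ = q² − M·y` of `γ` is POSITIVE, `≡ 1 (mod 8)` (for `4 ∣ M`, `q` odd), `≡ q² (mod M)`, and prime to `q` (from `M²·j·y ≡ −1 (mod q²)`) — the
data the `θ`-multiplier of `γ` is read from in T3 (`ε_δ = 1`, `(Mq²/δ) = 1` by reciprocity). [cite: AtkinLehner1970, §6] [cite: Shimura1973, Prop. 1.5] -/
theorem exists_gamma0_translate_mul_fricke_eq_normalised {M : ℕ} (hM0 : M ≠ 0) {q a b : ℤ}
    (hdet : q ^ 4 * a - (M : ℤ) * b = 1) (hq : Odd q) (hM4 : (4 : ℤ) ∣ (M : ℤ)) {j : ℤ} (hj : IsCoprime j q) :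
    ∃ (γ : SL(2, ℤ)) (y : ℤ), γ ∈ CongruenceSubgroup.Gamma0 M ∧ ((γ 1 1 : ℤ) : ZMod M) = (q : ZMod M) ^ 2 ∧
      ((γ 0 0 : ℤ) : ZMod M) = (q : ZMod M) ^ 2 * (a : ZMod M) ∧ (γ 1 0 : ℤ) = (M : ℤ) * q ^ 2 ∧
      (γ 1 1 : ℤ) = q ^ 2 - (M : ℤ) * y ∧ Even y ∧ 0 < (γ 1 1 : ℤ) ∧ (γ 1 1 : ℤ) % 8 = 1 ∧ IsCoprime (γ 1 1 : ℤ) q ∧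
      j * (M : ℤ) * y ≡ b [ZMOD q ^ 2] ∧ (M : ℤ) ^ 2 * j * y ≡ -1 [ZMOD q ^ 2] ∧
      (∃ d : ℕ, (γ 1 1 : ℤ) = d ∧ J((M : ℤ) * q ^ 2 | d) = 1) ∧
      !![q ^ 2, j; 0, q ^ 2] * !![q ^ 4 * a, b; (M : ℤ) * q ^ 4, q ^ 4] =
        (γ : Matrix (Fin 2) (Fin 2) ℤ) * !![q ^ 4, q ^ 2 * y; 0, q ^ 4] := by
  obtain ⟨y₀, hy₀⟩ := exists_mul_mul_modEq_of_fricke_det hdet hj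
  -- an even non-positive representative of `y₀ mod q²`
  set y : ℤ := y₀ * (1 - q ^ 2) - 2 * q ^ 2 * |y₀ * (1 - q ^ 2)| with hydef
  have hyy₀ : y ≡ y₀ [ZMOD q ^ 2] :=
    Int.modEq_iff_dvd.mpr ⟨y₀ + 2 * |y₀ * (1 - q ^ 2)|, by rw [hydef]; ring⟩
  have hy : j * (M : ℤ) * y ≡ b [ZMOD q ^ 2] := ((Int.ModEq.refl _).mul hyy₀).trans hy₀
  have hq2 : Even (1 - q ^ 2) := by
    obtain ⟨s, hs⟩ := eight_dvd_sq_sub_one_of_odd hq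
    exact ⟨-(4 * s), by linear_combination -hs⟩
  have hyeven : Even y := by
    rw [hydef]
    exact (hq2.mul_left y₀).sub ((even_two.mul_right _).mul_right _)
  have hq0 : q ≠ 0 := by rintro rfl; exact absurd hq (by decide)
  have hq1 : 1 ≤ q ^ 2 := by nlinarith [sq_nonneg (|q| - 1), Int.one_le_abs hq0, sq_abs q]
  have hyle : y ≤ 0 := by
    rw [hydef]
    nlinarith [le_abs_self (y₀ * (1 - q ^ 2)), abs_nonneg (y₀ * (1 - q ^ 2)), hq1]
  obtain ⟨c, hc⟩ : (q ^ 2 : ℤ) ∣ b - j * (M : ℤ) * y := Int.ModEq.dvd hy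
  have hneg1 : (M : ℤ) ^ 2 * j * y ≡ -1 [ZMOD q ^ 2] := sq_mul_mul_modEq_neg_one_of_solution hdet hy
  -- the lower-right entry `δ = q² − My`
  have hδpos : 0 < q ^ 2 - (M : ℤ) * y := by
    have hM0 : (0 : ℤ) ≤ (M : ℤ) := Int.natCast_nonneg M
    have hq0' : 0 < q ^ 2 := by positivity
    nlinarith
  have hδ8 : (q ^ 2 - (M : ℤ) * y) % 8 = 1 := by
    obtain ⟨s, hs⟩ := eight_dvd_sq_sub_one_of_odd hq
    obtain ⟨m4, hm4⟩ := hM4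
    obtain ⟨y2, hy2⟩ := hyeven
    have : q ^ 2 - (M : ℤ) * y = 8 * (s - m4 * y2) + 1 := by
      rw [hm4, hy2]; linear_combination hs
    omega
  have hδcop : IsCoprime (q ^ 2 - (M : ℤ) * y) q := by
    obtain ⟨k, hk⟩ := Int.modEq_iff_dvd.mp hneg1.symm
    -- `hk : -1 - M²jy = q² k`, so `(−M²j)·y + (−qk)·q = 1`: `y` is prime to `q`
    have hyq : IsCoprime y q := ⟨-((M : ℤ) ^ 2 * j), q * k, by linear_combination -hk⟩
    have hMq : IsCoprime (M : ℤ) q := (isCoprime_of_fricke_det hdet).symm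
    have hMy : IsCoprime (-((M : ℤ) * y)) q := (hMq.mul_left hyq).neg_left
    have e : q ^ 2 - (M : ℤ) * y = -((M : ℤ) * y) + q * q := by ring
    rw [e]
    exact hMy.add_mul_left_left q
  -- the Jacobi value of the multiplier
  have hδJ : J((M : ℤ) * q ^ 2 | (q ^ 2 - (M : ℤ) * y).toNat) = 1 := by
    have hcast : (((q ^ 2 - (M : ℤ) * y).toNat : ℕ) : ℤ) = q ^ 2 - (M : ℤ) * y := Int.toNat_of_nonneg hδpos.le
    refine jacobiSym_level_mul_sq_eq_one hM0 ?_ ?_ ?_ (isCoprime_of_fricke_det hdet)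
    · have : ((q ^ 2 - (M : ℤ) * y).toNat : ℤ) % 8 = 1 := by rw [hcast]; exact hδ8
      omega
    · rw [hcast]
      exact Int.modEq_iff_dvd.mpr ⟨y, by ring⟩
    · rw [hcast]; exact hδcop.symm
  refine ⟨⟨!![q ^ 2 * a + j * M, c + j - a * y; (M : ℤ) * q ^ 2, q ^ 2 - (M : ℤ) * y], det_gammaJ_eq_one hdet hc⟩, y,
    ?_, ?_, ?_, ?_, ?_, hyeven, ?_, ?_, ?_, hy, hneg1, ⟨(q ^ 2 - (M : ℤ) * y).toNat, ?_, hδJ⟩, ?_⟩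
  · rw [CongruenceSubgroup.Gamma0_mem]
    simp
  · simp
  · simp
  · simp
  · simp
  · simpa using hδpos
  · simpa using hδ8
  · simpa using hδcop
  · simpa using (Int.toNat_of_nonneg hδpos.le).symm
  · exact translate_mul_fricke_eq hc

/-! ## §4 Fricke data exist -/

/-- For `q` prime to `M` there are `a, b` with `q⁴a − Mb = 1` (Bézout for `q⁴` and `M`). [folklore] -/
theorem exists_fricke_det {M q : ℤ} (h : IsCoprime q M) : ∃ a b : ℤ, q ^ 4 * a - M * b = 1 := by
  obtain ⟨u, v, huv⟩ := (h.pow_left (m := 4))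
  exact ⟨u, -v, by linear_combination huv⟩

end Summit.BirchSwinnertonDyer.BirchSwinnertonDyer.Theorems.PrintCFram.FlipRung
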